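import Summits.Schanuel.Schanuel.Theorems.RootDecomp1BQuadFrame03

/-!
# RootDecomp1BQuadFrame — lens 4, generation 36 ADDENDUM «QUADRATIC FRAMES» (B-R23 (ii)(b)): the (1|ρ) At-cells and 5 ≤ polarDeg (1, ρ) for EVERY ρ ∈ `QuadHyperLiouville` (hyper-approximable by real quadratic irrationals) modulo `Roy2014_thm_1_1` ONLY, with the NAMED member ρ_Q = √2 + λ_H of FINITE irrationality exponent — continuation (RootDecomp1BQuadFrame04): §M the NAMED member ρ_Q = √2 + λ_H with FINITE irrationality exponent (`rhoQ_finite_exponent`, `not_liouville_rhoQ`)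

(lens-4 g36 ADDENDUM `QuadFrame.lean` [HOME/decomp-schanuel-lens-4/g36/ sha256 ffb0c3af…, 1516 l; NODE L1950 / REQUEST L1951; critic VERDICT L1957 (B-R23 (ii)(b) cell credit, RULE B-R24, port GO)]; port by census-1 gen 17 as
`RootDecomp1BQuadFrame01`–`05` — see the PORT NOTE of part 01; `--supports stmt-Schanuel-32406`; rung 0.)
-/

noncomputable section

open Complex IntermediateField MvPolynomial

namespace Summit.Schanuel.Schanuel.Theorems.RootDecomp1BQuadFrame

open Summit.Schanuel.Schanuel.Theorems.RootDecomp1EPointTransfer (Roy2014_thm_1_1)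
open Summit.Schanuel.Schanuel.Theorems.RootDecomp1KHyper (mvlen mvlen_nonneg abs_coeff_le_mvlen one_le_mvlen
  exists_ball_eval_ne_zero mvlen_add_le mvlen_sub_le mvlen_mul_le mvlen_C_mul_le mvlen_sum_le)
open Summit.Schanuel.Schanuel.Theorems.RootDecomp1BHyperFrame (royDeg royS RoyNF roy_tree_iff framePt Ff
  Ff_eq_aeval exists_lipschitz_Ff gcoef gcoef_ne_zero apply_zero_le_totalDegree engine_endgame
  trdeg_adjoin_le_of_isAlgebraic' linearIndependent_one_irrational)
open Summit.Schanuel.Schanuel.Theorems.RootDecomp1BFedFlagCore (KleinIH polarDeg polarField)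
open Summit.Schanuel.Schanuel.Theorems.RootDecomp1BDefectFloorDefs (SharpRelativeLindemannAt TameDefectZeroAt
  WildSharpDefectZeroAt WildSharpDefectZeroInitAt WildSharpInitAt)
open Summit.Schanuel.Schanuel.Theorems.RootDecomp1BDefectFloorCells (natCast_le_trdeg_of_algebraicIndependent)
open Summit.Schanuel.Schanuel.Theorems.RootDecomp1BRadicalDescent (exists_int_relation norm_mvaeval_le_mvlen)
open Summit.Schanuel.Schanuel.Theorems.RootDecomp1BMovingZero (mem_polarField_one mem_polarField_swap)

/-! ## §M  A NAMED MEMBER with FINITE irrationality exponent: `ρ_Q = √2 + λ_H`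

`λ_H = Σ_k 2^{−a_k}` (`a₀ = 1`, `a_{k+1} = 2^{(k+1)a_k}`; the tree's hyper-Liouville constant).  The quadratic
irrationals `β_K = √2 + s_K` (`s_K = M_K/2^{a_K}` the partial sums) have naive height `≤ 2·4^{a_K}` and
`0 < ρ_Q − β_K ≤ 2·2^{−a_{K+1}}`: `ρ_Q ∈ QuadHyperLiouville`.  And `ρ_Q` has irrationality exponent `≤ 10`
(`|ρ_Q − p/q| ≥ 1/(64000 q¹⁰)`), by the effective measure `|√2 − u/v| ≥ 1/(5v²)` applied to `u/v = p/q − s_K` at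
the two scales `2^{a_K} ≤ 2q < 2^{a_{K+1}}`; in particular `ρ_Q` is NOT Liouville, so it lies in NONE of the
rational-regime classes of the cell (`HyperLiouville`, `LiouvilleOrder k` (`k ≥ 3`), `UltraLiouville`). -/

section Member

open Summit.Schanuel.Schanuel.Theorems.RootDecomp1KHyper.HyperCell (HyperLiouville hexp hexp_zero hexp_succ lambdaH
  lambdaH_partialSum lambdaH_tail_pos lambdaH_tail_le lambdaH_eq_partialSum_add_tail succ_le_hexp lambdaH_le_one)

/-- **Effective irrationality measure of `√2`:** `|√2 − u/v| ≥ 1/(5v²)`. -/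
theorem sqrt_two_sub_rat_ge (u : ℤ) {v : ℕ} (hv : 0 < v) :
    1 / (5 * (v : ℝ) ^ 2) ≤ |Real.sqrt 2 - u / v| := by
  have hv0 : (0 : ℝ) < v := by exact_mod_cast hv
  have hvne : (v : ℝ) ≠ 0 := hv0.ne'
  have hv1 : (1 : ℝ) ≤ v := by exact_mod_cast hv
  have hs2 : Real.sqrt 2 ^ 2 = 2 := Real.sq_sqrt (by norm_num)
  have hslt : Real.sqrt 2 < 3 / 2 := by
    rw [Real.sqrt_lt' (by norm_num)]; norm_num
  have hsgt : 1 < Real.sqrt 2 := by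
    rw [Real.lt_sqrt (by norm_num)]; norm_num
  by_cases hfar : 1 / 2 ≤ |Real.sqrt 2 - u / v|
  · refine le_trans ?_ hfar
    rw [div_le_div_iff₀ (by positivity) (by norm_num)]
    nlinarith
  · push Not at hfar
    set x : ℝ := (u : ℝ) / v with hx
    have hux : (u : ℝ) = x * v := by rw [hx]; field_simp
    obtain ⟨hlo, hhi⟩ := abs_sub_lt_iff.mp hfar
    have hxlo : 1 / 2 < x := by linarith
    have hxhi : x < 2 := by linarith
    -- the integer `2v² − u²` is non-zero
    have hne : (2 : ℝ) * (v : ℝ) ^ 2 - (u : ℝ) ^ 2 ≠ 0 := by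
      intro h
      have hv2 : (0 : ℝ) < (v : ℝ) ^ 2 := by positivity
      have hx2 : x ^ 2 = 2 := by
        have h' : x ^ 2 * (v : ℝ) ^ 2 = 2 * (v : ℝ) ^ 2 := by rw [hux] at h; nlinarith [h]
        exact mul_right_cancel₀ hv2.ne' h'
      have hxpos : 0 ≤ x := by linarith
      have hxeq : x = Real.sqrt 2 := by rw [← hx2, Real.sqrt_sq hxpos]
      refine irrational_sqrt_two.ne_rat ((u : ℚ) / (v : ℚ)) ?_
      rw [Rat.cast_div, Rat.cast_intCast, Rat.cast_natCast]
      exact hxeq.symm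
    have hint : (1 : ℝ) ≤ |2 * (v : ℝ) ^ 2 - (u : ℝ) ^ 2| := by
      have h : ((2 * (v : ℤ) ^ 2 - u ^ 2 : ℤ) : ℝ) = 2 * (v : ℝ) ^ 2 - (u : ℝ) ^ 2 := by push_cast; ring
      have hz : (2 * (v : ℤ) ^ 2 - u ^ 2 : ℤ) ≠ 0 := by
        intro hz; apply hne; rw [← h, hz]; simp
      rw [← h, ← Int.cast_abs]
      exact_mod_cast Int.one_le_abs hz
    -- `|2v² − u²| = v² · |√2 − x| · (√2 + x)`
    have hfac : 2 * (v : ℝ) ^ 2 - (u : ℝ) ^ 2 = (v : ℝ) ^ 2 * ((Real.sqrt 2 - x) * (Real.sqrt 2 + x)) := by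
      rw [hux]; linear_combination (-(v : ℝ) ^ 2) * hs2
    have hsum0 : 0 < Real.sqrt 2 + x := by linarith
    have habs : |2 * (v : ℝ) ^ 2 - (u : ℝ) ^ 2| = (v : ℝ) ^ 2 * (|Real.sqrt 2 - x| * (Real.sqrt 2 + x)) := by
      rw [hfac, abs_mul, abs_mul, abs_of_pos (pow_pos hv0 2), abs_of_pos hsum0]
    rw [habs] at hint
    have hsum : Real.sqrt 2 + x ≤ 7 / 2 := by linarith
    have h72 : (v : ℝ) ^ 2 * (|Real.sqrt 2 - x| * (Real.sqrt 2 + x)) ≤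
        (v : ℝ) ^ 2 * (|Real.sqrt 2 - x| * (7 / 2)) :=
      mul_le_mul_of_nonneg_left (mul_le_mul_of_nonneg_left hsum (abs_nonneg _)) (by positivity)
    have hnn : 0 ≤ (v : ℝ) ^ 2 * |Real.sqrt 2 - x| := by positivity
    rw [div_le_iff₀ (by positivity)]
    nlinarith [hint, h72, hnn]

/-- `exp 1 ≤ 4`. -/
private theorem exp_one_le_four : Real.exp 1 ≤ 4 := by
  have := Real.exp_one_lt_d9; norm_num at this; linarith

/-- **The named member** `ρ_Q = √2 + λ_H`. -/
def rhoQ : ℝ := Real.sqrt 2 + lambdaH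

/-- The partial sum / tail decomposition of `λ_H` at level `K`: `λ_H = M/2^{a_K} + T`, `M ≤ 2^{a_K}` natural,
`0 < T ≤ 2/2^{a_{K+1}}`. -/
theorem lambdaH_split (K : ℕ) : ∃ (M : ℕ) (T : ℝ), lambdaH = (M : ℝ) / (2 : ℝ) ^ hexp K + T ∧
    M ≤ 2 ^ hexp K ∧ 0 < T ∧ T ≤ 2 / (2 : ℝ) ^ hexp (K + 1) := by
  obtain ⟨M, -, hM⟩ := lambdaH_partialSum K
  have hsplit := lambdaH_eq_partialSum_add_tail (K + 1)
  rw [hM] at hsplit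
  have hTpos := lambdaH_tail_pos (K + 1)
  have hTle := lambdaH_tail_le (K + 1)
  have hTle' : ∑' k, 1 / (2 : ℝ) ^ hexp (k + (K + 1)) ≤ 2 / (2 : ℝ) ^ hexp (K + 1) :=
    hTle.trans (le_of_eq (by ring))
  refine ⟨M, _, hsplit, ?_, hTpos, hTle'⟩
  have h2 : (0 : ℝ) < (2 : ℝ) ^ hexp K := by positivity
  have hlt : (M : ℝ) / (2 : ℝ) ^ hexp K < 1 := by linarith [lambdaH_le_one]
  rw [div_lt_one h2] at hlt
  exact_mod_cast hlt.le

/-- **The key inequality at scale `K`:** `|ρ_Q − p/q| ≥ 1/(5 (q·2^{a_K})²) − 2/2^{a_{K+1}}`. -/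
theorem abs_rhoQ_sub_rat_ge (K : ℕ) (p : ℤ) {q : ℕ} (hq : 0 < q) :
    1 / (5 * ((q : ℝ) * 2 ^ hexp K) ^ 2) - 2 / (2 : ℝ) ^ hexp (K + 1) ≤ |rhoQ - p / q| := by
  obtain ⟨M, T, hlam, -, hTpos, hTle⟩ := lambdaH_split K
  have hq0 : (0 : ℝ) < q := by exact_mod_cast hq
  have hqne : (q : ℝ) ≠ 0 := hq0.ne'
  have h2 : (0 : ℝ) < (2 : ℝ) ^ hexp K := by positivity
  have h2ne : (2 : ℝ) ^ hexp K ≠ 0 := h2.ne'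
  -- `u / v = p/q − M/2^{a_K}`
  have hv : 0 < q * 2 ^ hexp K := Nat.mul_pos hq (Nat.two_pow_pos _)
  have key := sqrt_two_sub_rat_ge (p * 2 ^ hexp K - M * q) hv
  have huv : (((p * 2 ^ hexp K - M * q : ℤ)) : ℝ) / ((q * 2 ^ hexp K : ℕ) : ℝ) =
      (p : ℝ) / q - (M : ℝ) / (2 : ℝ) ^ hexp K := by
    push_cast
    field_simp
  rw [huv] at key
  have hv2 : (((q * 2 ^ hexp K : ℕ)) : ℝ) = (q : ℝ) * 2 ^ hexp K := by push_cast; ring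
  rw [hv2] at key
  have hdec : rhoQ - p / q = (Real.sqrt 2 - ((p : ℝ) / q - (M : ℝ) / (2 : ℝ) ^ hexp K)) + T := by
    rw [rhoQ, hlam]; ring
  rw [hdec]
  have htri := abs_sub (Real.sqrt 2 - ((p : ℝ) / q - (M : ℝ) / (2 : ℝ) ^ hexp K) + T) T
  rw [add_sub_cancel_right, abs_of_pos hTpos] at htri
  linarith

/-- Tower growth: `20 · (2^{a_{K+1}})⁴ ≤ 2^{a_{K+2}}`. -/
theorem hexp_growth (K : ℕ) : 20 * (2 ^ hexp (K + 1)) ^ 4 ≤ 2 ^ hexp (K + 2) := by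
  have hK2 : 2 ≤ hexp (K + 1) := le_trans (by omega) (succ_le_hexp (K + 1))
  -- `16^n ≥ 20 n⁴` for `n ≥ 4`
  have h16 : ∀ n, 4 ≤ n → 20 * n ^ 4 ≤ 16 ^ n := by
    intro n hn
    induction n, hn using Nat.le_induction with
    | base => norm_num
    | succ n hn ih =>
        have h1 : (n + 1) ^ 4 ≤ (2 * n) ^ 4 := Nat.pow_le_pow_left (by omega) 4
        calc 20 * (n + 1) ^ 4 ≤ 20 * (2 * n) ^ 4 := by gcongr
          _ = 16 * (20 * n ^ 4) := by ring
          _ ≤ 16 * 16 ^ n := by gcongr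
          _ = 16 ^ (n + 1) := by ring
  set N : ℕ := 2 ^ hexp (K + 1) with hN
  have hN4 : 4 ≤ N := by
    rw [hN]
    calc 4 = 2 ^ 2 := by norm_num
      _ ≤ 2 ^ hexp (K + 1) := Nat.pow_le_pow_right (by norm_num) hK2
  -- `a_{K+2} = 2^{(K+2) a_{K+1}} ≥ 2^{2 a_{K+1}} = N²`, so `2^{a_{K+2}} ≥ 2^{N²} ≥ 2^{4N} = 16^N`
  have hexp2 : N * N ≤ hexp (K + 2) := by
    rw [show K + 2 = (K + 1) + 1 by omega, hexp_succ, hN, ← pow_add]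
    exact Nat.pow_le_pow_right (by norm_num) (by nlinarith)
  calc 20 * N ^ 4 ≤ 16 ^ N := h16 N hN4
    _ = 2 ^ (4 * N) := by rw [pow_mul]; norm_num
    _ ≤ 2 ^ (N * N) := Nat.pow_le_pow_right (by norm_num) (by nlinarith)
    _ ≤ 2 ^ hexp (K + 2) := Nat.pow_le_pow_right (by norm_num) hexp2

/-- The scale of a denominator: `2^{a_k} ≤ 2q < 2^{a_{k+1}}` for some `k`. -/
theorem exists_scale {q : ℕ} (hq : 0 < q) : ∃ k, 2 ^ hexp k ≤ 2 * q ∧ 2 * q < 2 ^ hexp (k + 1) := by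
  classical
  have hex : ∃ k, 2 * q < 2 ^ hexp (k + 1) :=
    ⟨2 * q, lt_of_lt_of_le (lt_of_lt_of_le (by omega) (succ_le_hexp (2 * q + 1))) Nat.lt_two_pow_self.le⟩
  refine ⟨Nat.find hex, ?_, Nat.find_spec hex⟩
  rcases Nat.eq_zero_or_pos (Nat.find hex) with h | h
  · rw [h, hexp_zero, pow_one]; omega
  · obtain ⟨j, hj⟩ : ∃ j, Nat.find hex = j + 1 := ⟨Nat.find hex - 1, by omega⟩
    have hmin := Nat.find_min hex (m := j) (by omega)
    rw [hj]
    exact not_lt.mp hmin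

/-- arithmetic of regimes (i)/(ii): `20 q² Q² ≤ Q'` turns the scale inequality into `≥ 1/(10 q² Q²)`. -/
private theorem regime_bound {q Q Q' : ℝ} (hq : 0 < q) (hQ : 0 < Q) (h : 20 * q ^ 2 * Q ^ 2 ≤ Q') :
    1 / (10 * q ^ 2 * Q ^ 2) ≤ 1 / (5 * (q * Q) ^ 2) - 2 / Q' := by
  have hqQ : 0 < 10 * q ^ 2 * Q ^ 2 := by positivity
  have hQ' : 0 < Q' := lt_of_lt_of_le (by positivity) h
  have h1 : 2 / Q' ≤ 1 / (10 * q ^ 2 * Q ^ 2) := by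
    rw [div_le_div_iff₀ hQ' hqQ]; nlinarith
  have h2 : 1 / (5 * (q * Q) ^ 2) = 2 / (10 * q ^ 2 * Q ^ 2) := by
    rw [div_eq_div_iff (by positivity) (by positivity)]; ring
  rw [h2]
  have h3 : 2 / (10 * q ^ 2 * Q ^ 2) = 1 / (10 * q ^ 2 * Q ^ 2) + 1 / (10 * q ^ 2 * Q ^ 2) := by ring
  linarith

/-- **Finite irrationality exponent of `ρ_Q`, explicitly:** `|ρ_Q − p/q| ≥ 1/(64000·q¹⁰)`. -/
theorem abs_rhoQ_sub_rat_ge_pow (p : ℤ) {q : ℕ} (hq : 0 < q) :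
    1 / (64000 * (q : ℝ) ^ 10) ≤ |rhoQ - p / q| := by
  obtain ⟨k, hk1, hk2⟩ := exists_scale hq
  have hq0 : (0 : ℝ) < q := by exact_mod_cast hq
  have hq1 : (1 : ℝ) ≤ q := by exact_mod_cast hq
  have hQk : ((2 : ℝ) ^ hexp k) ≤ 2 * q := by exact_mod_cast hk1
  have hQk1 : 2 * (q : ℝ) < (2 : ℝ) ^ hexp (k + 1) := by exact_mod_cast hk2
  have hgrow : 20 * ((2 : ℝ) ^ hexp (k + 1)) ^ 4 ≤ (2 : ℝ) ^ hexp (k + 2) := by exact_mod_cast hexp_growth k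
  have hQpos : (0 : ℝ) < (2 : ℝ) ^ hexp k := by positivity
  have hQ1pos : (0 : ℝ) < (2 : ℝ) ^ hexp (k + 1) := by positivity
  have hX : ((2 : ℝ) ^ hexp k) ^ 2 ≤ (2 * q) ^ 2 := pow_le_pow_left₀ hQpos.le hQk 2
  by_cases hreg : 20 * (q : ℝ) ^ 2 * ((2 : ℝ) ^ hexp k) ^ 2 ≤ (2 : ℝ) ^ hexp (k + 1)
  · -- regime (i): scale `k`
    refine le_trans ?_ ((regime_bound hq0 hQpos hreg).trans (abs_rhoQ_sub_rat_ge k p hq))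
    apply one_div_le_one_div_of_le (by positivity)
    have hq410 : (q : ℝ) ^ 4 ≤ (q : ℝ) ^ 10 := pow_le_pow_right₀ hq1 (by norm_num)
    calc 10 * (q : ℝ) ^ 2 * ((2 : ℝ) ^ hexp k) ^ 2 ≤ 10 * (q : ℝ) ^ 2 * (2 * q) ^ 2 := by gcongr
      _ = 40 * (q : ℝ) ^ 4 := by ring
      _ ≤ 64000 * (q : ℝ) ^ 10 := by linarith [pow_nonneg hq0.le 10]
  · -- regime (ii): scale `k + 1`
    push Not at hreg
    have hqQ1 : (q : ℝ) ^ 2 ≤ ((2 : ℝ) ^ hexp (k + 1)) ^ 2 :=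
      pow_le_pow_left₀ hq0.le (by linarith) 2
    have hreg' : 20 * (q : ℝ) ^ 2 * ((2 : ℝ) ^ hexp (k + 1)) ^ 2 ≤ (2 : ℝ) ^ hexp (k + 1 + 1) := by
      rw [show k + 1 + 1 = k + 2 from rfl]
      calc 20 * (q : ℝ) ^ 2 * ((2 : ℝ) ^ hexp (k + 1)) ^ 2
          ≤ 20 * ((2 : ℝ) ^ hexp (k + 1)) ^ 2 * ((2 : ℝ) ^ hexp (k + 1)) ^ 2 := by gcongr
        _ = 20 * ((2 : ℝ) ^ hexp (k + 1)) ^ 4 := by ring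
        _ ≤ (2 : ℝ) ^ hexp (k + 2) := hgrow
    refine le_trans ?_ ((regime_bound hq0 hQ1pos hreg').trans (abs_rhoQ_sub_rat_ge (k + 1) p hq))
    apply one_div_le_one_div_of_le (by positivity)
    -- `2^{a_{k+1}} < 20 q² (2^{a_k})² ≤ 80 q⁴`
    have h80 : (2 : ℝ) ^ hexp (k + 1) ≤ 80 * (q : ℝ) ^ 4 :=
      calc (2 : ℝ) ^ hexp (k + 1) ≤ 20 * (q : ℝ) ^ 2 * ((2 : ℝ) ^ hexp k) ^ 2 := hreg.le
        _ ≤ 20 * (q : ℝ) ^ 2 * (2 * q) ^ 2 := by gcongr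
        _ = 80 * (q : ℝ) ^ 4 := by ring
    calc 10 * (q : ℝ) ^ 2 * ((2 : ℝ) ^ hexp (k + 1)) ^ 2 ≤ 10 * (q : ℝ) ^ 2 * (80 * (q : ℝ) ^ 4) ^ 2 := by
          gcongr
      _ = 64000 * (q : ℝ) ^ 10 := by ring

/-- **`ρ_Q` has finite irrationality exponent** (`μ = 10`, `C = 1/64000`). -/
theorem rhoQ_finite_exponent :
    ∃ (μ : ℕ) (C : ℝ), 0 < C ∧ ∀ (p : ℤ) (q : ℕ), 0 < q → C / (q : ℝ) ^ μ ≤ |rhoQ - p / q| :=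
  ⟨10, 1 / 64000, by norm_num, fun p q hq => by rw [div_div]; exact abs_rhoQ_sub_rat_ge_pow p hq⟩

/-- **`ρ_Q` is NOT a Liouville number** (Mathlib's `Liouville`). -/
theorem not_liouville_rhoQ : ¬ Liouville rhoQ := by
  intro h
  obtain ⟨a, b, hb, -, hlt⟩ := h 27
  obtain ⟨n, rfl⟩ : ∃ n : ℕ, b = n := ⟨b.toNat, (Int.toNat_of_nonneg (by omega)).symm⟩
  have hn : 0 < n := by omega
  have hn2 : (2 : ℝ) ≤ n := by exact_mod_cast (show (2 : ℕ) ≤ n by omega)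
  have hge := abs_rhoQ_sub_rat_ge_pow a hn
  have hlt' : |rhoQ - a / n| < 1 / (n : ℝ) ^ 27 := by simpa [Int.cast_natCast] using hlt
  have hb17 : (131072 : ℝ) ≤ (n : ℝ) ^ 17 :=
    calc (131072 : ℝ) = 2 ^ 17 := by norm_num
      _ ≤ (n : ℝ) ^ 17 := pow_le_pow_left₀ (by norm_num) hn2 17
  have hb10 : (0 : ℝ) < (n : ℝ) ^ 10 := by positivity
  have hcmp : 1 / (n : ℝ) ^ 27 ≤ 1 / (64000 * (n : ℝ) ^ 10) := by
    apply one_div_le_one_div_of_le (by positivity)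
    calc 64000 * (n : ℝ) ^ 10 ≤ (n : ℝ) ^ 17 * (n : ℝ) ^ 10 := by nlinarith
      _ = (n : ℝ) ^ 27 := by ring
  linarith

/-- Hence `ρ_Q` lies in NONE of the rational-approximation classes of the earlier `(1|ρ)`-cells. -/
theorem not_hyperLiouville_rhoQ : ¬ HyperLiouville rhoQ := fun h => not_liouville_rhoQ h.liouville

/-- `ρ_Q` has no exponential Liouville order `k ≥ 3`. -/
theorem not_liouvilleOrder_rhoQ {k : ℕ} (hk : 3 ≤ k) :
    ¬ Summit.Schanuel.Schanuel.Theorems.RootDecomp1KGeneric.LiouvilleOrder k rhoQ :=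
  fun h => not_liouville_rhoQ (h.liouville hk)

/-- `ρ_Q` is not ultra-Liouville. -/
theorem not_ultraLiouville_rhoQ :
    ¬ Summit.Schanuel.Schanuel.Theorems.RootDecomp1BRadicalDescent.UltraLiouville rhoQ :=
  fun h => not_hyperLiouville_rhoQ h.hyperLiouville

set_option maxHeartbeats 800000 in
/-- **`ρ_Q ∈ QuadHyperLiouville`** — with the frames `β_K = √2 + M_K/2^{a_K}`, `K = 2m + 1`,
`a = 4^{a_K}`, `b = −2M_K 2^{a_K}`, `c = M_K² − 2·4^{a_K}`, `A = 2·4^{a_K}`. -/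
theorem quadHyperLiouville_rhoQ : QuadHyperLiouville rhoQ := by
  intro m
  obtain ⟨K, hK⟩ : ∃ K : ℕ, K = 2 * m + 1 := ⟨_, rfl⟩
  obtain ⟨M, T, hlam, hMQ, hTpos, hTle⟩ := lambdaH_split K
  obtain ⟨Q, hQ⟩ : ∃ Q : ℕ, Q = 2 ^ hexp K := ⟨_, rfl⟩
  have hQR : (Q : ℝ) = (2 : ℝ) ^ hexp K := by rw [hQ]; norm_cast
  have hQpos : 0 < Q := by rw [hQ]; exact Nat.two_pow_pos _
  have hQ0 : (0 : ℝ) < Q := by exact_mod_cast hQpos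
  have hQne : (Q : ℝ) ≠ 0 := hQ0.ne'
  rw [← hQ] at hMQ
  have hMQZ : (M : ℤ) ≤ Q := by exact_mod_cast hMQ
  have hM0Z : (0 : ℤ) ≤ M := by positivity
  have hQ0Z : (0 : ℤ) ≤ Q := by positivity
  -- the frame
  set t : ℝ := (M : ℝ) / Q with ht
  have hQt : (Q : ℝ) * t = M := by rw [ht]; field_simp
  have hs2 : Real.sqrt 2 ^ 2 = 2 := Real.sq_sqrt (by norm_num)
  have hdiff : rhoQ - (Real.sqrt 2 + t) = T := by rw [rhoQ, hlam, ht, hQR]; ring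
  refine ⟨Real.sqrt 2 + t, (Q : ℤ) ^ 2, -(2 * (M : ℤ) * Q), (M : ℤ) ^ 2 - 2 * (Q : ℤ) ^ 2, 2 * Q ^ 2,
    ?_, ?_, ?_, ?_, ?_, ?_, ?_, ?_, ?_⟩
  · -- `m ≤ A = 2Q²`: `Q = 2^{a_K} > a_K ≥ K + 1 = 2m + 2`
    have h1 : K + 1 ≤ hexp K := succ_le_hexp K
    have h2 : hexp K < Q := by rw [hQ]; exact Nat.lt_two_pow_self
    have hmQ : m ≤ Q := by omega
    calc m ≤ Q := hmQ
      _ ≤ 2 * Q ^ 2 := by nlinarith [hQpos]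
  · -- irrational
    have e : Real.sqrt 2 + t = Real.sqrt 2 + (((M : ℚ) / (Q : ℚ) : ℚ) : ℝ) := by
      rw [ht, Rat.cast_div, Rat.cast_natCast, Rat.cast_natCast]
    rw [e]; exact irrational_sqrt_two.add_ratCast _
  · exact pow_ne_zero 2 (by exact_mod_cast hQpos.ne')
  · push_cast
    linear_combination ((Q : ℝ)) ^ 2 * hs2 + (2 * (Q : ℝ) * Real.sqrt 2 + ((Q : ℝ) * t - M)) * hQt
  · push_cast; rw [abs_of_nonneg (by positivity)]; nlinarith
  · push_cast; rw [abs_neg, abs_of_nonneg (by positivity)]; nlinarith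
  · push_cast
    rw [abs_le]; constructor <;> nlinarith
  · -- `β ≠ ρ_Q`
    intro h
    rw [← h, sub_self] at hdiff
    exact hTpos.ne hdiff
  · -- the distance: `T ≤ 2/2^{a_{K+1}} < exp(−A^m)`
    rw [show |rhoQ - (Real.sqrt 2 + t)| = T by rw [hdiff, abs_of_pos hTpos]]
    -- ℕ bookkeeping: `2 A^m + 2 ≤ a_{K+1}` with `A = 2Q² = 2^{2a_K+1}`
    obtain ⟨A', hA'⟩ : ∃ A' : ℕ, A' = 2 * Q ^ 2 := ⟨_, rfl⟩
    have hA'pow : A' = 2 ^ (2 * hexp K + 1) := by rw [hA', hQ]; ring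
    have ha : 2 * m + 2 ≤ hexp K := by have := succ_le_hexp K; omega
    have hlt : 2 * A' ^ m + 2 ≤ hexp (K + 1) := by
      have hK1 : K + 1 = 2 * m + 2 := by omega
      rw [hexp_succ, hA'pow, ← pow_mul, hK1]
      have hx : (2 * hexp K + 1) * m + 2 ≤ (2 * m + 2) * hexp K := by nlinarith [ha]
      have h2le : 2 ≤ 2 ^ ((2 * hexp K + 1) * m + 1) := by
        rw [pow_succ]; have := Nat.one_le_two_pow (n := (2 * hexp K + 1) * m); omega
      calc 2 * 2 ^ ((2 * hexp K + 1) * m) + 2 = 2 ^ ((2 * hexp K + 1) * m + 1) + 2 := by ring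
        _ ≤ 2 ^ ((2 * hexp K + 1) * m + 1) + 2 ^ ((2 * hexp K + 1) * m + 1) := by omega
        _ = 2 ^ ((2 * hexp K + 1) * m + 2) := by ring
        _ ≤ 2 ^ ((2 * m + 2) * hexp K) := Nat.pow_le_pow_right (by norm_num) hx
    -- real form
    have hcast : ((2 * Q ^ 2 : ℕ) : ℝ) = (A' : ℝ) := by rw [hA']
    rw [hcast]
    have hexpA : Real.exp ((A' : ℝ) ^ m) ≤ (4 : ℝ) ^ (A' ^ m) := by
      have e : Real.exp ((A' : ℝ) ^ m) = Real.exp 1 ^ (A' ^ m) := by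
        rw [← Real.exp_nat_mul]; norm_num
      rw [e]; exact pow_le_pow_left₀ (Real.exp_pos 1).le exp_one_le_four _
    have e2 : (2 : ℝ) ^ (2 * A' ^ m + 2) = 4 * (4 : ℝ) ^ (A' ^ m) := by
      rw [pow_add, pow_mul]; norm_num [mul_comm]
    have hpow : 4 * (4 : ℝ) ^ (A' ^ m) ≤ (2 : ℝ) ^ hexp (K + 1) := by
      rw [← e2]; exact pow_le_pow_right₀ (by norm_num) hlt
    have h2h : (0 : ℝ) < (2 : ℝ) ^ hexp (K + 1) := by positivity
    have h4 : 4 * Real.exp ((A' : ℝ) ^ m) ≤ (2 : ℝ) ^ hexp (K + 1) := by linarith [hexpA, hpow]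
    have key : (4 : ℝ) ≤ Real.exp (-((A' : ℝ) ^ m)) * (2 : ℝ) ^ hexp (K + 1) := by
      have h5 := mul_le_mul_of_nonneg_left h4 (Real.exp_pos (-((A' : ℝ) ^ m))).le
      have e : Real.exp (-((A' : ℝ) ^ m)) * (4 * Real.exp ((A' : ℝ) ^ m)) = 4 := by
        rw [mul_left_comm, ← Real.exp_add, neg_add_cancel, Real.exp_zero, mul_one]
      linarith
    calc T ≤ 2 / (2 : ℝ) ^ hexp (K + 1) := hTle
      _ < Real.exp (-((A' : ℝ) ^ m)) := by rw [div_lt_iff₀ h2h]; linarith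

end Member

end Summit.Schanuel.Schanuel.Theorems.RootDecomp1BQuadFrame

end
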